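import Mathlib
import Literature.NumberTheory.Transcendental.GammaMonomialsDistribution
import HarnessLib

/-!
# The Beta symbol group and the Koblitz–Ogus lattice

Pure algebra behind "Hodge-type products of Beta values" (Deligne, LNM 900, §7, Thm. 7.18 with the
Koblitz–Ogus appendix; Kubert–Lang distributions):

* `BetaSymbol.BSym = ℤ[ℚ × ℚ]`, the free abelian group on pairs of rationals — the generator
  `[a, b] = bsym a b` stands for (the logarithm of) `B(a,b)`; `msym` of a multiset (a Beta word);
  `wordSym`/`wordMultiset` of indexed data.
* The STANDARD RELATOR PAIRS `relatorPairs` (multisets `(L, R)` with `Π B(L) = const · Π B(R)`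
  classically): symmetry, translation `B(a,b) = ((a+b)/a) B(a+1,b)`, Dirichlet re-association
  `B(a,b)B(a+b,c) = B(b,c)B(a,b+c)` (Andrews–Askey–Roy Thm 1.8.1), the pure-Beta Gauss
  multiplication `Π_{k<n} B(k/n,s) = n^{ns−1} Π_{j<n} B(s,js)` (`multL`, `multR`, from Thm 1.5.2),
  Euler reflection `B(a,1−a) = B(½,½)/sin πa`, unit `B(1,1) = 1`; their span `RelSpan`.
* The HODGE WEIGHT `weight : BSym →+ ℤ`, `[a,b] ↦ [a∉ℤ] + [b∉ℤ] − [a+b∉ℤ]` (twice the weight in `π`).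
* Level-`D` symbols (`IsLevel`, `levelSym`) and the CLASS VECTOR `clD D : BSym →+ (ℤ/D → ℤ)`,
  `[a,b] ↦ e_{[a]} + e_{[b]} − e_{[a+b]}` (the Γ-monomial read modulo `Γ(x+1) = xΓ(x)`).
* The Koblitz–Ogus side in the exact spelling of `KoblitzOgus.hodge_eq_combination_int`
  (`GammaMonomialsDistribution.lean`, PROVED): `koBern`, `IsKOHodge`, `reflVec`, `distVec`,
  `koSpan`, and the repackaging `nsmul_mem_koSpan_of_isKOHodge` (Hodge type ⇒ a positive multiple
  lies in the span of reflection and distribution vectors).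

Everything here is a real definition or a proved lemma; no named facts. Consumers: the
`GammaHodgeSector` line of routes TerasomaMultiplication / MotivatedMoves (KontsevichZagierPeriods).

References: P. Deligne, *Hodge cycles on abelian varieties*, LNM 900 (1982), §7 [Deligne1982HodgeCycles];
G. Andrews, R. Askey, R. Roy, *Special Functions* (1999), §1.1–1.8 [AndrewsAskeyRoy1999].
-/

noncomputable section

open scoped BigOperators

namespace Literature.NumberTheory.Transcendental.BetaSymbol

/-! ## The symbol group and the standard relators -/

/-- The BETA SYMBOL GROUP: the free abelian group on pairs of rationals; the generator `[a, b]`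
stands for (the logarithm of) `B(a,b)`. [folklore] -/
abbrev BSym : Type := FreeAbelianGroup (ℚ × ℚ)

/-- The symbol `[a, b]`. [folklore] -/
def bsym (a b : ℚ) : BSym := FreeAbelianGroup.of (a, b)

/-- The symbol of a finite multiset of pairs (a Beta WORD). [folklore] -/
def msym (m : Multiset (ℚ × ℚ)) : BSym := (m.map fun p => bsym p.1 p.2).sum

/-- Left side of the pure-Beta Gauss multiplication of order `n` at `s`:
`Π_{k=1}^{n−1} β(k/n, s)`. [cite: AndrewsAskeyRoy1999, Thm 1.5.2] -/
def multL (n : ℕ) (s : ℚ) : Multiset (ℚ × ℚ) :=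
  (Finset.range (n - 1)).val.map fun k => ((((k + 1 : ℕ) : ℚ)) / n, s)

/-- Right side of the pure-Beta Gauss multiplication: `Π_{j=1}^{n−1} β(s, j s)`
(value `Γ(s)^n / Γ(ns)`; `Π_k B(k/n,s) = n^{ns−1} Π_j B(s, js)`). [cite: AndrewsAskeyRoy1999, Thm 1.5.2] -/
def multR (n : ℕ) (s : ℚ) : Multiset (ℚ × ℚ) :=
  (Finset.range (n - 1)).val.map fun j => (s, ((j + 1 : ℕ) : ℚ) * s)

/-- The STANDARD RELATOR PAIRS `(L, R)` (multisets of Beta symbols whose products agree up to a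
positive algebraic constant): symmetry `β(a,b) = β(b,a)`; translation `β(a,b) = ((a+b)/a) β(a+1,b)`;
Dirichlet re-association `β(a,b)β(a+b,c) = β(b,c)β(a,b+c)`; Gauss multiplication
`Π_k β(k/n,s) = n^{ns−1} Π_j β(s,js)`; Euler reflection `β(a,1−a) = β(½,½)/sin πa`; unit
`β(1,1) = 1`. [cite: AndrewsAskeyRoy1999, Thm 1.8.1] -/
def relatorPairs : Set (Multiset (ℚ × ℚ) × Multiset (ℚ × ℚ)) :=
  {p | ∃ a b : ℚ, 0 < a ∧ 0 < b ∧ p = ({(a, b)}, {(b, a)})} ∪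
  {p | ∃ a b : ℚ, 0 < a ∧ 0 < b ∧ p = ({(a, b)}, {(a + 1, b)})} ∪
  {p | ∃ a b c : ℚ, 0 < a ∧ 0 < b ∧ 0 < c ∧ p = ({(a, b), (a + b, c)}, {(b, c), (a, b + c)})} ∪
  {p | ∃ (n : ℕ) (s : ℚ), 2 ≤ n ∧ 0 < s ∧ p = (multL n s, multR n s)} ∪
  {p | ∃ a : ℚ, 0 < a ∧ a < 1 ∧ p = ({(a, 1 - a)}, {(1 / 2, 1 / 2)})} ∪
  {({((1 : ℚ), (1 : ℚ))}, 0)}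

/-- The span `RelSpan ≤ BSym` of the standard relators `sym L − sym R`. [folklore] -/
def RelSpan : AddSubgroup BSym :=
  AddSubgroup.closure ((fun p => msym p.1 - msym p.2) '' relatorPairs)

/-- `[a ∉ ℤ]` as an integer (`0` for integers, `1` otherwise). [folklore] -/
def fracInd (a : ℚ) : ℤ := if a.den = 1 then 0 else 1

/-- The HODGE WEIGHT of a symbol, `[a ∉ ℤ] + [b ∉ ℤ] − [a+b ∉ ℤ]` (twice the weight in `π`:
`β(½,½) = π` has weight `2`). [cite: Deligne1982HodgeCycles, §7] -/
def weight : BSym →+ ℤ :=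
  FreeAbelianGroup.lift fun p : ℚ × ℚ => fracInd p.1 + fracInd p.2 - fracInd (p.1 + p.2)

/-- The symbol `Σ_j [x_j, y_j]` of indexed data. [folklore] -/
def wordSym {N : ℕ} (x y : Fin N → ℚ) : BSym := ∑ j, bsym (x j) (y j)

/-- The same, as a multiset of pairs. [folklore] -/
def wordMultiset {N : ℕ} (x y : Fin N → ℚ) : Multiset (ℚ × ℚ) :=
  Finset.univ.val.map fun j => (x j, y j)

/-! ## Level-`D` symbols and class vectors -/

/-- `a` is a positive rational of LEVEL `D` (`a D ∈ ℤ`). [folklore] -/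
def IsLevel (D : ℕ) (a : ℚ) : Prop := 0 < a ∧ (a * D).den = 1

/-- The symbols of level `D`. [folklore] -/
def levelGen (D : ℕ) : Set BSym := {v | ∃ a b : ℚ, IsLevel D a ∧ IsLevel D b ∧ v = bsym a b}

/-- The subgroup of `BSym` generated by the symbols of level `D`. [folklore] -/
def levelSym (D : ℕ) : AddSubgroup BSym := AddSubgroup.closure (levelGen D)

/-- The class of a level-`D` rational in `ℤ/D` (`a ↦ a·D mod D`). [folklore] -/
def toZMod (D : ℕ) (a : ℚ) : ZMod D := (((a * D).num : ℤ) : ZMod D)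

/-- The basis vector `e_{[a]}` of `ℤ^{ℤ/D}`. [folklore] -/
def eZ (D : ℕ) (a : ℚ) : ZMod D → ℤ := fun x => if x = toZMod D a then 1 else 0

/-- The CLASS VECTOR of a symbol at level `D`: `[a,b] ↦ e_{[a]} + e_{[b]} − e_{[a+b]}`
(the Γ-monomial `Γ(a)Γ(b)/Γ(a+b)` read modulo `Γ(x+1) = xΓ(x)`). [cite: Deligne1982HodgeCycles, §7] -/
def clD (D : ℕ) : BSym →+ (ZMod D → ℤ) :=
  FreeAbelianGroup.lift fun p : ℚ × ℚ => eZ D p.1 + eZ D p.2 - eZ D (p.1 + p.2)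

/-! ## The Koblitz–Ogus side (spelling of `KoblitzOgus.hodge_eq_combination_int`) -/

/-- The Bernoulli distribution `β(x) = x/D − ½` (`x ≠ 0`), `β(0) = 0`. [cite: Deligne1982HodgeCycles, Rem. 7.16 (a)] -/
def koBern (D : ℕ) (x : ZMod D) : ℚ :=
  if x = (0 : ZMod D) then (0 : ℚ) else (((ZMod.val x : ℕ) : ℚ) / (D : ℚ) - 1 / 2)

/-- `f : ℤ/D → ℤ` is of HODGE TYPE in the sense of Koblitz–Ogus: `Σ_x f(x) β(ux) = 0` for every
unit `u`. [cite: Deligne1982HodgeCycles, Rem. 7.16 (a)] -/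
def IsKOHodge (D : ℕ) [NeZero D] (f : ZMod D → ℤ) : Prop :=
  ∀ u : ZMod D, IsUnit u → ∑ x : ZMod D, (f x : ℚ) * koBern D (u * x) = 0

/-- The reflection vector `e_a + e_{−a}`. [cite: Deligne1982HodgeCycles, Rem. 7.16 (a)] -/
def reflVec (D : ℕ) (a : ZMod D) : ZMod D → ℤ :=
  fun x => (if a = x then 1 else 0) + (if -a = x then 1 else 0)

/-- The distribution vector `Σ_{x ≡ y (M)} e_x − e_{(D/M) y}`. [cite: Deligne1982HodgeCycles, Rem. 7.16 (a)] -/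
def distVec (D M : ℕ) (y : ZMod D) : ZMod D → ℤ :=
  fun x => (if x.val % M = y.val % M then 1 else 0) - (if ((D / M : ℕ) : ZMod D) * y = x then 1 else 0)

/-- The Koblitz–Ogus span: reflections and distributions (`M ∣ D`). [cite: Deligne1982HodgeCycles, Rem. 7.16 (a)] -/
def koSpan (D : ℕ) : AddSubgroup (ZMod D → ℤ) :=
  AddSubgroup.closure ({v | ∃ a : ZMod D, v = reflVec D a} ∪
    {v | ∃ M ∈ D.divisors, ∃ y : ZMod D, v = distVec D M y})

/-! ## Basic API -/

/-- The weight of a symbol. [folklore] -/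
@[simp] theorem weight_bsym (a b : ℚ) : weight (bsym a b) = fracInd a + fracInd b - fracInd (a + b) := by
  simp [weight, bsym]

/-- `fracInd ½ = 1`. [folklore] -/
theorem fracInd_half : fracInd (1 / 2) = 1 := by
  simp [fracInd]

/-- `weight [½, ½] = 2`. [folklore] -/
theorem weight_betaHalf : weight (bsym (1 / 2) (1 / 2)) = 2 := by
  rw [weight_bsym, fracInd_half, show (1 / 2 : ℚ) + 1 / 2 = 1 by norm_num]
  simp [fracInd]

/-- The class vector of a symbol. [folklore] -/
@[simp] theorem clD_bsym (D : ℕ) (a b : ℚ) : clD D (bsym a b) = eZ D a + eZ D b - eZ D (a + b) := by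
  simp [clD, bsym]

/-- `msym` of the empty word. [folklore] -/
@[simp] theorem msym_zero : msym 0 = 0 := by
  simp [msym]

/-- `msym` of a cons. [folklore] -/
@[simp] theorem msym_cons (p : ℚ × ℚ) (m : Multiset (ℚ × ℚ)) : msym (p ::ₘ m) = bsym p.1 p.2 + msym m := by
  simp [msym]

/-- `msym` of a singleton. [folklore] -/
@[simp] theorem msym_singleton (p : ℚ × ℚ) : msym {p} = bsym p.1 p.2 := by
  simp [msym]

/-- `msym` is additive. [folklore] -/
theorem msym_add (m m' : Multiset (ℚ × ℚ)) : msym (m + m') = msym m + msym m' := by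
  simp [msym, Multiset.sum_add]

/-- `msym (n • m) = n • msym m`. [folklore] -/
theorem msym_nsmul (n : ℕ) (m : Multiset (ℚ × ℚ)) : msym (n • m) = n • msym m := by
  simp [msym, Multiset.map_nsmul, Multiset.sum_nsmul]

/-- The symbol of the word multiset is the word symbol. [folklore] -/
theorem msym_wordMultiset {N : ℕ} (x y : Fin N → ℚ) : msym (wordMultiset x y) = wordSym x y := by
  simp only [msym, wordMultiset, wordSym, Multiset.map_map, Function.comp_def]
  rfl

/-- A relator difference lies in `RelSpan`. [folklore] -/
theorem sub_mem_relSpan {L R : Multiset (ℚ × ℚ)} (h : (L, R) ∈ relatorPairs) :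
    msym L - msym R ∈ RelSpan :=
  AddSubgroup.subset_closure ⟨(L, R), h, rfl⟩

/-- A positive rational whose denominator divides `D` is of level `D`. [folklore] -/
theorem isLevel_of_den_dvd {D : ℕ} {a : ℚ} (ha : 0 < a) (h : a.den ∣ D) : IsLevel D a := by
  refine ⟨ha, ?_⟩
  rw [mul_comm, ← KoblitzOgus.cast_div_den_mul_num h]
  exact Rat.den_intCast _

/-- Level-`D` symbols lie in `levelSym D`. [folklore] -/
theorem bsym_mem_levelSym {D : ℕ} {a b : ℚ} (ha : IsLevel D a) (hb : IsLevel D b) :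
    bsym a b ∈ levelSym D :=
  AddSubgroup.subset_closure ⟨a, b, ha, hb, rfl⟩

/-- **Koblitz–Ogus, in span form**: a Hodge-type `f : ℤ/D → ℤ` has a positive multiple in the
Koblitz–Ogus span (repackaging of `KoblitzOgus.hodge_eq_combination_int`, PROVED in the tree).
[cite: Deligne1982HodgeCycles, Rem. 7.16 (a)] -/
theorem nsmul_mem_koSpan_of_isKOHodge (D : ℕ) [NeZero D] {f : ZMod D → ℤ} (hf : IsKOHodge D f) :
    ∃ n₀ : ℕ, 0 < n₀ ∧ (n₀ : ℤ) • f ∈ koSpan D := by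
  classical
  obtain ⟨n₀, hn₀, mr, md, h⟩ := KoblitzOgus.hodge_eq_combination_int f hf
  refine ⟨n₀, hn₀, ?_⟩
  have hfun : (n₀ : ℤ) • f = ∑ a : ZMod D, mr a • reflVec D a +
      ∑ M ∈ D.divisors, ∑ y : ZMod D, md M y • distVec D M y := by
    funext x
    simp only [Pi.smul_apply, smul_eq_mul, Pi.add_apply, Finset.sum_apply, reflVec, distVec]
    exact h x
  rw [hfun]
  refine add_mem (sum_mem fun a _ => ?_) (sum_mem fun M hM => sum_mem fun y _ => ?_)
  · have ha : reflVec D a ∈ ({v | ∃ a : ZMod D, v = reflVec D a} ∪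
        {v | ∃ M ∈ D.divisors, ∃ y : ZMod D, v = distVec D M y}) := Or.inl ⟨a, rfl⟩
    exact zsmul_mem (AddSubgroup.subset_closure ha : reflVec D a ∈ koSpan D) (mr a)
  · have hy : distVec D M y ∈ ({v | ∃ a : ZMod D, v = reflVec D a} ∪
        {v | ∃ M ∈ D.divisors, ∃ y : ZMod D, v = distVec D M y}) := Or.inr ⟨M, hM, y, rfl⟩
    exact zsmul_mem (AddSubgroup.subset_closure hy : distVec D M y ∈ koSpan D) (md M y)

end Literature.NumberTheory.Transcendental.BetaSymbol
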